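import Summits.HodgeConjecture.CorCM.Census.OddSliceGenerators

/-!
# Odd slices, III: the upper bound — (number of simple factors) `− 1` Galois orbits DO generate, so b17's parity law is an equality

COR-CM (cell `pub-hodgecm2`), count-neutral kernel census by the binder seat b09 (gen 24; lane DEG22-MU, answering lit-andre-3's
ask A6-R35 «`ℤ/22`: is `μ = 93`?»), in the generic odd-slice model of `Census/OddDegreeParityLaw.lean` (b17 gen 48) — no `decide`
table, no certificate, no named fact, no geometry, no `sorry`.  HC_CM is not proved anywhere in this cell; nothing here is a
headline and nothing here produces a period.

Part III of three.  THE THEOREM (`hodgeLattice_le_pairs_sup_span_genFamily`, `exists_generators_card_add_one_le`,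
`min_generators_eq`): in the generic odd-slice model, for a slice containing the curve block `e` (`A_e = 0`) and the full
single-defect block `b₁` (`π_{b₁}` bijective with inverse `σ`, `φ_{b₁} = 𝟙_{y=0}`), all `π_b` surjective,
  `H ≤ P + Σ_{t ∈ S} ℤ[G]·t`  for  `S = genFamily = {v_b : b ∉ {e,b₁}} ∪ {weilVec e b₁}`,  `|S| ≤ |ι| − 1`;
hence with b17's `card_le_card_add_one_of_generates` (all `|A_b|` odd) the least number of Galois orbits generating the Hodge
lattice modulo divisor classes is EXACTLY `|ι| − 1` = the number of simple factors other than `E`... minus nothing: `|ι| − 1` counts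
the non-`E` blocks.  Instances (dictionary arithmetic, as in the parity-law file): `μ(ℤ/6) = 1, μ(ℤ/10) = 3, μ(ℤ/14) = 9` (the landed
per-degree certificates), `μ(ℤ/18) = 29, μ(ℤ/6×ℤ/3) = 31, μ(ℤ/22) = 93, μ(ℤ/26) = 315, μ(ℤ/30) = 1095, μ(ℤ/34) = 3855`, and
`μ(ℤ/2p) = (2^{p−1} − 1)/p` for every odd prime `p` — lit-andre-3's «`ℤ/2p` law» (PORTFOLIO-g13 §3.4) with equality in every degree.
Geometric reading (dictionary): modulo divisor classes the Hodge ring of the whole odd slice is generated by the Galois conjugates of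
ONE Weil class (on `E^{|A|−2} × B₁`) and, for each other simple factor `B_b`, ONE class of degree `2K_b` on `B_b × B₁ × E^{K_b−1}`.
PROOF (kernel, parts I–II supply the pieces).  For `u ∈ H`: `u = (u − red u) + (red u − clear u) + clear u` with the first summand in
`P` (part I), the second in the span of the translates of `genFamily` (part II), and `clear u` Hodge and supported on the even labels
of `b₁` and on `(e,0,0)` (part II).  KEY LEMMA (`eq_smul_weil0_of_support`, this file): such a vector `r` equals
`r_{(b₁,0,0)} · weil0` with `weil0 = half(b₁) − ε(|A_{b₁}| − 2)·e_{(e,0,0)}`, because the form of `(0,t)` on it reads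
`Σ_z r_z − 2 r_{−π₁ t} + ε r_E = 0` for every `t` (single defect + fullness of `B₁` ⇒ `z ↦ r_z` constant); and `weil0 ≡ weilVec φ e b₁`
modulo pairs (`weil0_sub_weilVec_mem_pairs`, via `n₀(b₁) = |A_{b₁}| − 1`, `d(b₁) = |A_{b₁}| − 2`).  NOT CLAIMED: anything for
`|G| ≡ 0 (mod 4)`; that the generators can be taken among rank-four faces (true by certificate for the cyclic prime types of degree
`10, 14, 22, 26, 34` — seat note `HOME/pub-hodgecm2-b09/lean-g24/DEG22-MU.md` —, not formalised).  All [folklore].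

## References
* [Pohlmann1968] H. Pohlmann, Algebraic cycles on abelian varieties of complex multiplication type, Ann. of Math. 88 (1968), Thm 1.
* [Milne1999] J. S. Milne, Lefschetz motives and the Tate conjecture, Compositio Math. 117 (1999), Prop. 2.1, p. 54.
* [Weil1977HodgeRing] A. Weil, Abelian varieties and the Hodge ring, Œuvres Scientifiques III, [1977c], 421–429.
-/

namespace Summit.HodgeConjecture.CorCM.Census.OddSliceUpperBound

open Finset
open Summit.HodgeConjecture.CorCM.Census.OddDegreeParityLaw
open Summit.HodgeConjecture.CorCM.Census.OddSliceTranslation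
open Summit.HodgeConjecture.CorCM.Census.OddSliceGenerators

variable {A : Type*} [AddCommGroup A]
variable {ι : Type*} [Fintype ι] [DecidableEq ι]
variable {Ab : ι → Type*} [∀ b, AddCommGroup (Ab b)] [∀ b, Fintype (Ab b)] [∀ b, DecidableEq (Ab b)]

section Main

variable (π : ∀ b, A →+ Ab b) (φ : ∀ b, Ab b → ZMod 2) (e b₁ : ι) (σ : Ab b₁ → A)

/-! ## §1 The key lemma: Hodge vectors supported on `B₁ ∪ E` are multiples of the Weil vector -/

/-- The normalised Weil vector `half(b₁) − ε(|A_{b₁}| − 2)·e_{(e,0,0)}` (= `weilVec φ e b₁` modulo pairs). [folklore] -/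
def weil0 : Pt Ab → ℤ :=
  ∑ z : Ab b₁, Pi.single (⟨b₁, (0, z)⟩ : Pt Ab) 1 +
    (-(sgnE φ e * ((Fintype.card (Ab b₁) : ℤ) - 2))) • Pi.single (⟨e, (0, 0)⟩ : Pt Ab) 1

/-- **Key lemma.** A Hodge vector supported on the even labels of `b₁` and on `(e,0,0)` is a multiple of `weil0`: its coefficients on
`B₁` are constant because the form of `(0,t)` reads `Σ_z r_z − 2 r_{−π₁ t} + ε r_E = 0` for every `t`. [folklore] -/
theorem eq_smul_weil0_of_support (include_he : ∀ y : Ab e, y = 0) (include_hne : b₁ ≠ e)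
    (include_hσ : ∀ z : Ab b₁, π b₁ (σ z) = z) (include_hφ₁ : ∀ z : Ab b₁, φ b₁ z = 1 ↔ z = 0)
    (r : Pt Ab → ℤ) (hr : r ∈ hodgeLattice π φ)
    (hsupp : ∀ x : Pt Ab, r x ≠ 0 → (x.1 = b₁ ∧ x.2.1 = 0) ∨ x = ⟨e, (0, 0)⟩) :
    r = r ⟨b₁, (0, 0)⟩ • weil0 φ e b₁ := by
  have h01 : ∀ a : ZMod 2, a = 0 ∨ a = 1 := by decide
  -- (a) explicit form of `r`
  set R : Pt Ab → ℤ := ∑ z : Ab b₁, r ⟨b₁, (0, z)⟩ • Pi.single (⟨b₁, (0, z)⟩ : Pt Ab) 1 +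
      r ⟨e, (0, 0)⟩ • Pi.single (⟨e, (0, 0)⟩ : Pt Ab) 1 with hR
  have hRb1 : ∀ (a : ZMod 2) (y : Ab b₁), R ⟨b₁, (a, y)⟩ = if a = 0 then r ⟨b₁, (0, y)⟩ else 0 := by
    intro a y
    rw [hR, Pi.add_apply, Finset.sum_apply, Pi.smul_apply, single_apply_of_ne include_hne, smul_zero, add_zero]
    simp only [Pi.smul_apply, smul_eq_mul, single_apply_same]
    rcases h01 a with rfl | rfl
    · have : ∀ z : Ab b₁, r ⟨b₁, (0, z)⟩ * (if ((0 : ZMod 2), y) = (0, z) then (1 : ℤ) else 0) =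
          if y = z then r ⟨b₁, (0, z)⟩ else 0 := by
        intro z
        by_cases h : y = z
        · subst h; simp
        · rw [if_neg h, if_neg (fun hh => h ((pair_zero_eq_iff y z).mp hh)), mul_zero]
      rw [Finset.sum_congr rfl fun z _ => this z, Finset.sum_ite_eq, if_pos (Finset.mem_univ _), if_pos rfl]
    · have : ∀ z : Ab b₁, r ⟨b₁, (0, z)⟩ * (if ((1 : ZMod 2), y) = (0, z) then (1 : ℤ) else 0) = 0 := by
        intro z
        rw [if_neg (pair_one_ne_pair_zero y z), mul_zero]
      rw [Finset.sum_congr rfl fun z _ => this z, Finset.sum_const_zero, if_neg (by decide)]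
  have hRe : ∀ (a : ZMod 2) (y : Ab e), R ⟨e, (a, y)⟩ = if a = 0 then r ⟨e, (0, 0)⟩ else 0 := by
    intro a y
    have hy : y = 0 := include_he y
    subst hy
    rw [hR, Pi.add_apply, Finset.sum_apply, Pi.smul_apply,
      Finset.sum_eq_zero fun z _ => by rw [Pi.smul_apply, single_apply_of_ne (Ne.symm include_hne), smul_zero],
      zero_add, smul_eq_mul, single_apply_same]
    rcases h01 a with rfl | rfl
    · simp
    · rw [if_neg (pair_one_ne_pair_zero (0 : Ab e) 0), mul_zero, if_neg (by decide)]
  have hRother : ∀ (b : ι) (hb : b ≠ b₁) (hbe : b ≠ e) (p : ZMod 2 × Ab b), R ⟨b, p⟩ = 0 := by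
    intro b hb hbe p
    rw [hR, Pi.add_apply, Finset.sum_apply, Pi.smul_apply,
      Finset.sum_eq_zero fun z _ => by rw [Pi.smul_apply, single_apply_of_ne hb, smul_zero],
      zero_add, single_apply_of_ne hbe, smul_zero]
  have hrR : r = R := by
    funext x
    obtain ⟨b, a, y⟩ := x
    by_cases hb : b = b₁
    · subst hb
      rw [hRb1]
      rcases h01 a with rfl | rfl
      · rw [if_pos rfl]
      · rw [if_neg (by decide)]
        by_contra h
        rcases hsupp ⟨b, (1, y)⟩ h with h' | h'
        · exact absurd h'.2 (by simp)
        · exact include_hne (congrArg Sigma.fst h')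
    · by_cases hbe : b = e
      · subst hbe
        rw [hRe]
        have hy : y = 0 := include_he y
        subst hy
        rcases h01 a with rfl | rfl
        · rw [if_pos rfl]
        · rw [if_neg (by decide)]
          by_contra h
          rcases hsupp ⟨b, (1, 0)⟩ h with h' | h'
          · exact hb h'.1
          · exact pair_one_ne_pair_zero (0 : Ab b) 0 (eq_of_heq (Sigma.mk.inj_iff.mp h').2)
      · rw [hRother b hb hbe]
        by_contra h
        rcases hsupp ⟨b, (a, y)⟩ h with h' | h'
        · exact hb h'.1
        · exact hbe (congrArg Sigma.fst h')
  -- (b) the forms of `(0,t)` on `R`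
  have hform : ∀ t : A, hodgeVec π φ (0, t) ⬝ᵥ R =
      (∑ z : Ab b₁, r ⟨b₁, (0, z)⟩) - 2 * r ⟨b₁, (0, -π b₁ t)⟩ + r ⟨e, (0, 0)⟩ * sgnE φ e := by
    intro t
    rw [hR, dotProduct_add, hodgeVec_zero_dotProduct_sum_b1 π φ b₁ include_hφ₁,
      hodgeVec_zero_dotProduct_single_e0 π φ e include_he, if_pos (Finset.mem_univ _)]
  have hzero : ∀ t : A, hodgeVec π φ (0, t) ⬝ᵥ R = 0 := by
    intro t; rw [← hrR]; exact hr (0, t)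
  -- (c) the coefficients on `b₁` are constant
  have hconst : ∀ z : Ab b₁, r ⟨b₁, (0, z)⟩ = r ⟨b₁, (0, 0)⟩ := by
    intro z
    have h1 := hzero (σ (-z))
    have h2 := hzero 0
    rw [hform, include_hσ, neg_neg] at h1
    rw [hform, map_zero, neg_zero] at h2
    linarith
  -- (d) the `E`-coefficient
  have hE : r ⟨e, (0, 0)⟩ = -(sgnE φ e * ((Fintype.card (Ab b₁) : ℤ) - 2)) * r ⟨b₁, (0, 0)⟩ := by
    have h2 := hzero 0
    rw [hform, map_zero, neg_zero, Finset.sum_congr rfl fun z _ => hconst z, Finset.sum_const, Finset.card_univ,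
      nsmul_eq_mul] at h2
    have hs := sgnE_mul_self φ e
    have h3 : r ⟨e, (0, 0)⟩ * sgnE φ e = -((Fintype.card (Ab b₁) : ℤ) * r ⟨b₁, (0, 0)⟩ - 2 * r ⟨b₁, (0, 0)⟩) := by
      linarith
    calc r ⟨e, (0, 0)⟩ = r ⟨e, (0, 0)⟩ * (sgnE φ e * sgnE φ e) := by rw [hs, mul_one]
      _ = (r ⟨e, (0, 0)⟩ * sgnE φ e) * sgnE φ e := by ring
      _ = -((Fintype.card (Ab b₁) : ℤ) * r ⟨b₁, (0, 0)⟩ - 2 * r ⟨b₁, (0, 0)⟩) * sgnE φ e := by rw [h3]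
      _ = -(sgnE φ e * ((Fintype.card (Ab b₁) : ℤ) - 2)) * r ⟨b₁, (0, 0)⟩ := by ring
  -- (e) assemble
  have hRw : R = r ⟨b₁, (0, 0)⟩ • weil0 φ e b₁ := by
    rw [hR, weil0, smul_add, Finset.smul_sum, smul_smul, Finset.sum_congr rfl fun z _ => by rw [hconst z], hE]
    congr 1
    rw [mul_comm]
  exact hrR.trans hRw

omit [Fintype ι] [DecidableEq ι] in
/-- `n₀(b₁) = |A_{b₁}| − 1` for the single-defect type. [folklore] -/
theorem n0_b1 (include_hφ₁ : ∀ z : Ab b₁, φ b₁ z = 1 ↔ z = 0) : n0 φ b₁ + 1 = Fintype.card (Ab b₁) := by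
  have h01 : ∀ a : ZMod 2, a = 0 ∨ a = 1 := by decide
  unfold n0
  have hfilt : (univ.filter fun y : Ab b₁ => φ b₁ y = 0) = univ.erase 0 := by
    ext y
    simp only [Finset.mem_filter, Finset.mem_univ, true_and, Finset.mem_erase, and_true]
    constructor
    · intro h hy
      have := (include_hφ₁ y).mpr hy
      rw [h] at this
      exact absurd this (by decide)
    · intro hy
      rcases h01 (φ b₁ y) with h | h
      · exact h
      · exact absurd ((include_hφ₁ y).mp h) hy
  rw [hfilt, Finset.card_erase_of_mem (Finset.mem_univ _), Finset.card_univ]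
  have : 0 < Fintype.card (Ab b₁) := Fintype.card_pos
  omega

omit [Fintype ι] [∀ b, AddCommGroup (Ab b)] in
/-- `half(b₁)` is the sum of the unit vectors at the even labels of `b₁`. [folklore] -/
theorem half_eq_sum : half (Ab := Ab) b₁ = ∑ z : Ab b₁, Pi.single (⟨b₁, (0, z)⟩ : Pt Ab) (1 : ℤ) := by
  have h01 : ∀ a : ZMod 2, a = 0 ∨ a = 1 := by decide
  funext x
  obtain ⟨b, a, y⟩ := x
  rw [Finset.sum_apply]
  by_cases hb : b = b₁
  · subst hb
    rw [Finset.sum_congr rfl fun z _ => single_apply_same b (0, z) (a, y) (1 : ℤ)]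
    rcases h01 a with rfl | rfl
    · have hl : half (Ab := Ab) b ⟨b, ((0 : ZMod 2), y)⟩ = 1 := by simp [half]
      have h2 : ∀ z : Ab b, (if ((0 : ZMod 2), y) = ((0 : ZMod 2), z) then (1 : ℤ) else 0) = if y = z then 1 else 0 := by
        intro z
        by_cases h : y = z
        · subst h; simp
        · rw [if_neg h, if_neg (fun hh => h ((pair_zero_eq_iff y z).mp hh))]
      rw [hl, Finset.sum_congr rfl fun z _ => h2 z, Finset.sum_ite_eq, if_pos (Finset.mem_univ _)]
    · have hl : half (Ab := Ab) b ⟨b, ((1 : ZMod 2), y)⟩ = 0 := by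
        simp only [half, true_and]
        rw [if_neg (by decide)]
      have h2 : ∀ z : Ab b, (if ((1 : ZMod 2), y) = ((0 : ZMod 2), z) then (1 : ℤ) else 0) = 0 := by
        intro z
        rw [if_neg (pair_one_ne_pair_zero y z)]
      rw [hl, Finset.sum_congr rfl fun z _ => h2 z, Finset.sum_const_zero]
  · have hl : half (Ab := Ab) b₁ ⟨b, (a, y)⟩ = 0 := by
      simp only [half]
      rw [if_neg (fun h => hb h.1)]
    rw [hl, Finset.sum_eq_zero fun z _ => single_apply_of_ne hb _ _ _]

omit [Fintype ι] in
/-- `weil0` is the Weil vector of `B₁` modulo pairs. [folklore] -/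
theorem weil0_sub_weilVec_mem_pairs (include_hφ₁ : ∀ z : Ab b₁, φ b₁ z = 1 ↔ z = 0) :
    weil0 φ e b₁ - weilVec φ e b₁ ∈ (pairs : Submodule ℤ (Pt Ab → ℤ)) := by
  have h01 : ∀ a : ZMod 2, a = 0 ∨ a = 1 := by decide
  have hd : defect φ b₁ = (Fintype.card (Ab b₁) : ℤ) - 2 := by
    unfold defect
    have h := n0_b1 φ b₁ include_hφ₁
    have h' : (n0 φ b₁ : ℤ) = (Fintype.card (Ab b₁) : ℤ) - 1 := by
      have h2 : ((n0 φ b₁ + 1 : ℕ) : ℤ) = (Fintype.card (Ab b₁) : ℤ) := by rw [h]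
      push_cast at h2
      linarith
    rw [h']; ring
  set N : ℤ := (Fintype.card (Ab b₁) : ℤ) with hN
  unfold weil0 weilVec
  rw [← half_eq_sum, hd]
  rcases h01 (φ e 0) with h0 | h1
  · -- `ε = 1`: the Weil vector carries the odd label `(e,1,0) = pairVec (e,1,0) − (e,0,0)`
    have hs : sgnE φ e = 1 := by simp [sgnE, h0]
    have hlab : (⟨e, (φ e 0 + 1, 0)⟩ : Pt Ab) = ⟨e, (1, 0)⟩ := by rw [h0, zero_add]
    have hpair : (Pi.single (⟨e, (1, 0)⟩ : Pt Ab) (1 : ℤ) : Pt Ab → ℤ) =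
        pairVec ⟨e, (1, 0)⟩ - Pi.single (⟨e, (0, 0)⟩ : Pt Ab) 1 := by
      have hc : conj (⟨e, (1, 0)⟩ : Pt Ab) = ⟨e, (0, 0)⟩ := by
        show (⟨e, ((1 : ZMod 2) + 1, (0 : Ab e))⟩ : Pt Ab) = ⟨e, (0, 0)⟩
        rw [(by decide : (1 : ZMod 2) + 1 = 0)]
      rw [pairVec, hc, add_sub_cancel_right]
    rw [hs, hlab, hpair, one_mul, smul_sub]
    have : half b₁ + -(N - 2) • (Pi.single (⟨e, (0, 0)⟩ : Pt Ab) (1 : ℤ) : Pt Ab → ℤ) -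
        (half b₁ + ((N - 2) • pairVec ⟨e, (1, 0)⟩ - (N - 2) • (Pi.single (⟨e, (0, 0)⟩ : Pt Ab) (1 : ℤ) : Pt Ab → ℤ))) =
        -((N - 2) • pairVec ⟨e, (1, 0)⟩) := by
      rw [neg_smul]; abel
    rw [this]
    exact Submodule.neg_mem _ (Submodule.smul_mem _ _ (Submodule.subset_span ⟨_, rfl⟩))
  · -- `ε = −1`: the Weil vector carries the even label `(e,0,0)` itself
    have hs : sgnE φ e = -1 := by simp [sgnE, h1]
    have hlab : (⟨e, (φ e 0 + 1, 0)⟩ : Pt Ab) = ⟨e, (0, 0)⟩ := by rw [h1, (by decide : (1 : ZMod 2) + 1 = 0)]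
    rw [hs, hlab]
    have : half b₁ + -(-1 * (N - 2)) • (Pi.single (⟨e, (0, 0)⟩ : Pt Ab) (1 : ℤ) : Pt Ab → ℤ) -
        (half b₁ + (N - 2) • (Pi.single (⟨e, (0, 0)⟩ : Pt Ab) (1 : ℤ) : Pt Ab → ℤ)) = 0 := by
      rw [neg_mul, one_mul, neg_neg, sub_self]
    rw [this]
    exact Submodule.zero_mem _

/-! ## §2 The theorem -/

/-- **THE ODD-SLICE UPPER BOUND.**  In a slice containing the curve block `e` (`A_e = 0`) and the full single-defect block `b₁`
(`π_{b₁}` bijective with inverse `σ`, `φ_{b₁} = 𝟙_{y=0}`), with all `π_b` surjective: the Hodge lattice is generated, together with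
the divisor classes, by the Galois translates of the `|ι| − 1` vectors of `genFamily` (one `v_b` per block `b ∉ {e,b₁}` and the Weil
vector of `E^{|A|−2} × B₁`). [folklore] -/
theorem hodgeLattice_le_pairs_sup_span_genFamily (include_he : ∀ y : Ab e, y = 0) (include_hne : b₁ ≠ e)
    (include_hσ : ∀ z : Ab b₁, π b₁ (σ z) = z) (include_hσ' : ∀ y : A, σ (π b₁ y) = y)
    (include_hφ₁ : ∀ z : Ab b₁, φ b₁ z = 1 ↔ z = 0) (hπ : ∀ b, Function.Surjective (π b)) :
    hodgeLattice π φ ≤ pairs ⊔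
      Submodule.span ℤ {v | ∃ g : ZMod 2 × A, ∃ t ∈ genFamily π φ e b₁ σ, v = transl π g t} := by
  intro u hu
  set W := Submodule.span ℤ {v | ∃ g : ZMod 2 × A, ∃ t ∈ genFamily π φ e b₁ σ, v = transl π g t} with hW
  -- the cleared vector is a multiple of `weil0`, which lies in `pairs ⊔ W`
  have hrmem : clear π φ e b₁ σ hπ u ∈ hodgeLattice π φ := clear_mem π φ e b₁ σ include_he include_hσ' include_hφ₁ hπ hu
  have hreq : clear π φ e b₁ σ hπ u = clear π φ e b₁ σ hπ u ⟨b₁, (0, 0)⟩ • weil0 φ e b₁ :=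
    eq_smul_weil0_of_support π φ e b₁ σ include_he include_hne include_hσ include_hφ₁ _ hrmem
      (clear_support π φ e b₁ σ include_he include_hne hπ u)
  have hweil : weilVec φ e b₁ ∈ W := by
    refine Submodule.subset_span ⟨0, weilVec φ e b₁, ?_, ?_⟩
    · unfold genFamily; exact Finset.mem_union_right _ (Finset.mem_singleton_self _)
    · funext y
      show weilVec φ e b₁ y = weilVec φ e b₁ (act π (-0) y)
      rw [neg_zero]
      congr 1
      obtain ⟨b, a, z⟩ := y
      show (⟨b, (a, z)⟩ : Pt Ab) = ⟨b, (a + (0 : ZMod 2 × A).1, z + π b (0 : ZMod 2 × A).2)⟩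
      simp
  have hweil0 : weil0 φ e b₁ ∈ pairs ⊔ W := by
    have : weil0 φ e b₁ = (weil0 φ e b₁ - weilVec φ e b₁) + weilVec φ e b₁ := by abel
    rw [this]
    exact Submodule.add_mem _ (Submodule.mem_sup_left (weil0_sub_weilVec_mem_pairs φ e b₁ include_hφ₁))
      (Submodule.mem_sup_right hweil)
  have hr' : clear π φ e b₁ σ hπ u ∈ pairs ⊔ W := by rw [hreq]; exact Submodule.smul_mem _ _ hweil0
  -- reassemble `u = (u − red u) + (red u − clear u) + clear u`
  have hdecomp : u = (u - red u) + (red u - clear π φ e b₁ σ hπ u) + clear π φ e b₁ σ hπ u := by abel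
  rw [hdecomp]
  exact Submodule.add_mem _ (Submodule.add_mem _ (Submodule.mem_sup_left (sub_red_mem_pairs u))
    (Submodule.mem_sup_right (red_sub_clear_mem_span π φ e b₁ σ hπ u))) hr'

/-- **Existence form**: some family of at most `|ι| − 1` vectors generates the Hodge lattice modulo pairs under translation. [folklore] -/
theorem exists_generators_card_add_one_le (include_he : ∀ y : Ab e, y = 0) (include_hne : b₁ ≠ e)
    (include_hσ : ∀ z : Ab b₁, π b₁ (σ z) = z) (include_hσ' : ∀ y : A, σ (π b₁ y) = y)
    (include_hφ₁ : ∀ z : Ab b₁, φ b₁ z = 1 ↔ z = 0) (hπ : ∀ b, Function.Surjective (π b)) :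
    ∃ S : Finset (Pt Ab → ℤ), S.card + 1 ≤ Fintype.card ι ∧
      hodgeLattice π φ ≤ pairs ⊔ Submodule.span ℤ {v | ∃ g : ZMod 2 × A, ∃ t ∈ S, v = transl π g t} :=
  ⟨genFamily π φ e b₁ σ, genFamily_card_le π φ e b₁ σ include_hne,
    hodgeLattice_le_pairs_sup_span_genFamily π φ e b₁ σ include_he include_hne include_hσ include_hσ' include_hφ₁ hπ⟩

/-- **`μ = |ι| − 1` EXACTLY in every odd slice** containing `E` and the full single-defect block: the least number of Galois orbits
generating the Hodge lattice modulo divisor classes equals the number of the other simple factors — b17's parity lower bound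
`card_le_card_add_one_of_generates` together with the upper bound of this file.  Instances (dictionary arithmetic): `μ(ℤ/2p) =
(2^{p−1} − 1)/p` for every odd prime `p` (`3, 9, 93, 315, 3855` for `2p = 10, 14, 22, 26, 34`), `μ(ℤ/18) = 29`, `μ(ℤ/6×ℤ/3) = 31`,
`μ(ℤ/30) = 1095`. [folklore] -/
theorem min_generators_eq (include_he : ∀ y : Ab e, y = 0) (include_hne : b₁ ≠ e)
    (include_hσ : ∀ z : Ab b₁, π b₁ (σ z) = z) (include_hσ' : ∀ y : A, σ (π b₁ y) = y)
    (include_hφ₁ : ∀ z : Ab b₁, φ b₁ z = 1 ↔ z = 0) (hπ : ∀ b, Function.Surjective (π b))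
    (hodd : ∀ b, Odd (Fintype.card (Ab b))) :
    (∃ S : Finset (Pt Ab → ℤ), S.card + 1 = Fintype.card ι ∧
        hodgeLattice π φ ≤ pairs ⊔ Submodule.span ℤ {v | ∃ g : ZMod 2 × A, ∃ t ∈ S, v = transl π g t}) ∧
      (∀ S : Finset (Pt Ab → ℤ),
        hodgeLattice π φ ≤ pairs ⊔ Submodule.span ℤ {v | ∃ g : ZMod 2 × A, ∃ t ∈ S, v = transl π g t} →
          Fintype.card ι ≤ S.card + 1) := by
  refine ⟨?_, fun S hS => card_le_card_add_one_of_generates π φ hodd e include_he S hS⟩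
  obtain ⟨S, hS, hgen⟩ :=
    exists_generators_card_add_one_le π φ e b₁ σ include_he include_hne include_hσ include_hσ' include_hφ₁ hπ
  exact ⟨S, le_antisymm hS (card_le_card_add_one_of_generates π φ hodd e include_he S hgen), hgen⟩

end Main

end Summit.HodgeConjecture.CorCM.Census.OddSliceUpperBound
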